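import Literature.Claims.NS.Ramm2024
import Literature.Analysis.FluidPDE.TaoFiniteEnergyLerayHopf
import Literature.Analysis.FluidPDE.ClayClassLerayHopfUniqueness
import Literature.Analysis.FluidPDE.LerayHopfMild
import Literature.Analysis.FluidPDE.LerayHopfRestartEverywhere
import Mathlib.Analysis.SpecialFunctions.JapaneseBracket
import Mathlib.Analysis.Calculus.MeanValue
import HarnessLib

/-!
# C04 `Ramm2024` — salvage: the TRUE steps of the typed skeleton, discharged in the kernel

Cell `ns-claims` (D-0090 NS-CLAIMS SWEEP), salvage seat `ns-claims-salvage-p1`. The claim skeleton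
`Literature/Claims/NS/Ramm2024.lean` (typist-4, p458819) types A. G. Ramm, *Modern Math. Methods*
2 (2024) 19–26 as eight `Prop`-valued steps; nothing there is asserted. This file PROVES the steps
that are true as typed, so that the refuter's per-step status table (TYPING-HYGIENE 11) can mark
them «kernel-discharged»:

* `step7_dataZero_holds : Step7_dataZero` — **Theorem 2.5 p. 25** («From b(0) = 0, it follows that
  v₀(x) = 0»): for a datum in the `Setting` (smooth, rapidly decaying), `b(0) = (2π)^{-3/2}‖∇v₀‖₂ = 0`
  forces `∇v₀ ≡ 0` (the gradient is continuous and square-integrable by rapid decay, so the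
  `toReal` in `b` is not a junk value), hence `v₀` is constant, hence `0` by decay. Ingredients:
  Mathlib `finite_integral_one_add_norm` (`∫ (1+|x|)^{-4} < ∞` on `ℝ³`), `is_const_of_fderiv_eq_zero`,
  `Continuous.ae_eq_iff_eq`.

* `step1_integralEquation_of_hasBoundedEnergy`, `step2_energyBound_of_hasBoundedEnergy` —
  **(1.6)/(1.12) pp. 20–21 and Theorem 1.1 (1.15) p. 21 in the finite-energy class**: for a solution
  in the `Setting` that ALSO has bounded energy (Clay (7), `HasBoundedEnergy v` — the print's (1.5)
  p. 20; referee F3 flag 2026-08-26T17:30:59Z, lead 17:35:52Z: as typed, `Setting` carries no energy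
  hypothesis and Steps 1–2 are then not provable, the spatially constant Galilean solutions
  `v(x,t) = a(t)`, `p = -a'(t)·x`, `a(0) = 0` being in the `Setting` with `‖v(t)‖₂ = ∞`), the
  solution is a global mild (Duhamel) solution and `‖v(·,t)‖₂ ≤ ‖v₀‖₂` for all `t ≥ 0`. Chain of
  TREE theorems (all proved): `IsNavierStokesSolution.isClassicalNSSolutionOn_Icc` →
  `isLerayHopfOn_of_finiteEnergy` (Tao 2013 Lemma 8.1: finite-energy classical solutions are
  Leray–Hopf, energy inequality included) → `IsLerayHopfOn.isMildNSSolutionOn_Ioc`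
  (Fabes–Jones–Rivière 1972 Thm 2.1: Leray–Hopf ⇒ mild) and `IsLerayHopfOn.weakGrad_energy`
  (Leray 1934 §31 energy inequality). If the skeleton's rev 2 adds the field
  `energy : HasBoundedEnergy v` to `Setting`, `Step1_integralEquation` and `Step2_energyBound`
  follow from these by one line each.

The predicted failing step (Step 3, (1.19)/(1.29) pp. 22–23) and its downstream (Step 5) are the
refuter's (`SoloRefuteRamm2024.lean`).

WHAT THIS IS NOT: not a claim about NS regularity or blow-up; not a claim about any author beyond
the typed locator.
-/

noncomputable section

open scoped ContDiff ENNReal Topology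
open MeasureTheory Set Filter

-- The mandated landing namespace repeats the summit name by design (D-0017).
set_option linter.dupNamespace false

namespace Summit.NavierStokesRegularity.NavierStokesRegularity.Theorems

namespace Ramm2024

open Literature.Claims.NS.Ramm2024 Literature.Analysis.FluidPDE

/-- The pointwise squared Frobenius norm of the gradient, `Σ_j ‖∂_j u(x)‖²` (written out; no
definition is introduced), is non-negative. [folklore] -/
theorem gradSq_nonneg (u : EuclideanSpace ℝ (Fin 3) → EuclideanSpace ℝ (Fin 3))
    (x : EuclideanSpace ℝ (Fin 3)) :
    0 ≤ ∑ j : Fin 3, ‖fderiv ℝ u x (EuclideanSpace.single j (1 : ℝ))‖ ^ 2 :=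
  Finset.sum_nonneg fun _ _ => sq_nonneg _

/-- The `ℝ≥0∞` integrand of `gradNorm` is `ofReal` of the real one. [folklore] -/
theorem integrand_eq_ofReal_gradSq (u : EuclideanSpace ℝ (Fin 3) → EuclideanSpace ℝ (Fin 3))
    (x : EuclideanSpace ℝ (Fin 3)) :
    (∑ j : Fin 3, ‖fderiv ℝ u x (EuclideanSpace.single j (1 : ℝ))‖ₑ ^ 2) =
      ENNReal.ofReal (∑ j : Fin 3, ‖fderiv ℝ u x (EuclideanSpace.single j (1 : ℝ))‖ ^ 2) := by
  rw [ENNReal.ofReal_sum_of_nonneg (fun _ _ => sq_nonneg _)]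
  refine Finset.sum_congr rfl fun j _ => ?_
  rw [← ofReal_norm, ENNReal.ofReal_pow (norm_nonneg _)]

/-- `x ↦ Σ_j ‖∂_j u(x)‖²` of a `C¹` field is continuous. [folklore] -/
theorem continuous_gradSq {u : EuclideanSpace ℝ (Fin 3) → EuclideanSpace ℝ (Fin 3)}
    (hu : ContDiff ℝ 1 u) :
    Continuous fun x => ∑ j : Fin 3, ‖fderiv ℝ u x (EuclideanSpace.single j (1 : ℝ))‖ ^ 2 := by
  have hc : Continuous (fderiv ℝ u) := hu.continuous_fderiv one_ne_zero
  refine continuous_finsetSum _ fun j _ => ?_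
  exact ((hc.clm_apply continuous_const).norm).pow 2

/-- **Rapid decay makes the gradient square-integrable**: for `u ∈ C^∞` with
`HasRapidSpatialDecay u`, `∫ Σ_j ‖∂_j u‖² < ∞` (pointwise `‖∇u(x)‖ ≤ C (1+|x|)^{-2}` from the decay
with `n = 1`, `K = 2`, and `∫_{ℝ³} (1+|x|)^{-4} < ∞`). [folklore] -/
theorem lintegral_gradSq_lt_top {u : EuclideanSpace ℝ (Fin 3) → EuclideanSpace ℝ (Fin 3)}
    (hd : HasRapidSpatialDecay u) :
    (∫⁻ x, ∑ j : Fin 3, ‖fderiv ℝ u x (EuclideanSpace.single j (1 : ℝ))‖ₑ ^ 2) < ⊤ := by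
  obtain ⟨C, hC⟩ := hd 1 2
  -- pointwise bound
  have hpt : ∀ x : EuclideanSpace ℝ (Fin 3),
      (∑ j : Fin 3, ‖fderiv ℝ u x (EuclideanSpace.single j (1 : ℝ))‖ₑ ^ 2) ≤
      ENNReal.ofReal (3 * C ^ 2) * ENNReal.ofReal ((1 + ‖x‖) ^ (-(4 : ℝ))) := by
    intro x
    have ha : 0 < 1 + ‖x‖ := by positivity
    have hFx : ‖fderiv ℝ u x‖ ≤ C / (1 + ‖x‖) ^ 2 := by
      rw [le_div_iff₀ (pow_pos ha 2), mul_comm, ← norm_iteratedFDeriv_one (𝕜 := ℝ)]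
      exact hC x
    have hC0 : 0 ≤ C := by
      have h0 := hC 0
      have : 0 ≤ (1 + ‖(0 : EuclideanSpace ℝ (Fin 3))‖) ^ 2 * ‖iteratedFDeriv ℝ 1 u 0‖ := by
        positivity
      linarith
    have hj : ∀ j : Fin 3, ‖fderiv ℝ u x (EuclideanSpace.single j (1 : ℝ))‖ ^ 2 ≤
        C ^ 2 * (1 + ‖x‖) ^ (-(4 : ℝ)) := by
      intro j
      have h1 : ‖fderiv ℝ u x (EuclideanSpace.single j (1 : ℝ))‖ ≤ C / (1 + ‖x‖) ^ 2 := by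
        refine (ContinuousLinearMap.le_opNorm _ _).trans ?_
        rw [PiLp.norm_single, norm_one, mul_one]
        exact hFx
      have h2 : (C / (1 + ‖x‖) ^ 2) ^ 2 = C ^ 2 * (1 + ‖x‖) ^ (-(4 : ℝ)) := by
        rw [Real.rpow_neg ha.le, show (4 : ℝ) = ((4 : ℕ) : ℝ) by norm_num, Real.rpow_natCast]
        field_simp
      rw [← h2]
      exact pow_le_pow_left₀ (norm_nonneg _) h1 2
    rw [integrand_eq_ofReal_gradSq, ← ENNReal.ofReal_mul (by positivity)]
    refine ENNReal.ofReal_le_ofReal ?_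
    calc ∑ j : Fin 3, ‖fderiv ℝ u x (EuclideanSpace.single j (1 : ℝ))‖ ^ 2
        ≤ ∑ _j : Fin 3, C ^ 2 * (1 + ‖x‖) ^ (-(4 : ℝ)) := Finset.sum_le_sum fun j _ => hj j
      _ = 3 * C ^ 2 * (1 + ‖x‖) ^ (-(4 : ℝ)) := by
        rw [Finset.sum_const, Finset.card_univ, Fintype.card_fin]; simp; ring
  calc (∫⁻ x, ∑ j : Fin 3, ‖fderiv ℝ u x (EuclideanSpace.single j (1 : ℝ))‖ₑ ^ 2)
      ≤ ∫⁻ x : EuclideanSpace ℝ (Fin 3),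
          ENNReal.ofReal (3 * C ^ 2) * ENNReal.ofReal ((1 + ‖x‖) ^ (-(4 : ℝ))) :=
        lintegral_mono hpt
    _ = ENNReal.ofReal (3 * C ^ 2) *
          ∫⁻ x : EuclideanSpace ℝ (Fin 3), ENNReal.ofReal ((1 + ‖x‖) ^ (-(4 : ℝ))) :=
        lintegral_const_mul _ (by fun_prop)
    _ < ⊤ := by
        refine ENNReal.mul_lt_top ENNReal.ofReal_lt_top ?_
        refine finite_integral_one_add_norm ?_
        rw [finrank_euclideanSpace, Fintype.card_fin]
        norm_num

/-- `gradNorm u` of a rapidly decaying smooth field is finite. [folklore] -/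
theorem gradNorm_ne_top {u : EuclideanSpace ℝ (Fin 3) → EuclideanSpace ℝ (Fin 3)}
    (hd : HasRapidSpatialDecay u) : gradNorm u ≠ ⊤ := by
  unfold gradNorm
  exact ENNReal.rpow_ne_top_of_nonneg (by norm_num) (lintegral_gradSq_lt_top hd).ne

/-- If `gradNorm u = 0` for a `C¹` field `u`, then every partial derivative vanishes everywhere
(the integrand is continuous and non-negative). [folklore] -/
theorem fderiv_apply_single_eq_zero_of_gradNorm_eq_zero
    {u : EuclideanSpace ℝ (Fin 3) → EuclideanSpace ℝ (Fin 3)} (hu : ContDiff ℝ 1 u)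
    (h0 : gradNorm u = 0) (x : EuclideanSpace ℝ (Fin 3)) (j : Fin 3) :
    fderiv ℝ u x (EuclideanSpace.single j (1 : ℝ)) = 0 := by
  have hL : (∫⁻ x, ∑ j : Fin 3, ‖fderiv ℝ u x (EuclideanSpace.single j (1 : ℝ))‖ₑ ^ 2) = 0 := by
    unfold gradNorm at h0
    rcases ENNReal.rpow_eq_zero_iff.1 h0 with ⟨h, _⟩ | ⟨_, h⟩
    · exact h
    · norm_num at h
  simp_rw [integrand_eq_ofReal_gradSq] at hL
  set g : EuclideanSpace ℝ (Fin 3) → ℝ :=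
    fun x => ∑ j : Fin 3, ‖fderiv ℝ u x (EuclideanSpace.single j (1 : ℝ))‖ ^ 2 with hg
  have hcont : Continuous g := continuous_gradSq hu
  have hae : (fun x => ENNReal.ofReal (g x)) =ᵐ[volume] 0 :=
    (lintegral_eq_zero_iff (by fun_prop)).1 hL
  have hae' : g =ᵐ[volume] (fun _ => (0 : ℝ)) := by
    filter_upwards [hae] with y hy
    have hy' : ENNReal.ofReal (g y) = 0 := hy
    exact le_antisymm (ENNReal.ofReal_eq_zero.1 hy') (gradSq_nonneg u y)
  have heq : g = fun _ => (0 : ℝ) := (hcont.ae_eq_iff_eq volume continuous_const).1 hae'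
  have hx : g x = 0 := congrFun heq x
  simp only [hg] at hx
  have hterm := (Finset.sum_eq_zero_iff_of_nonneg (fun i _ => sq_nonneg _)).1 hx j (Finset.mem_univ j)
  exact norm_eq_zero.1 (pow_eq_zero_iff two_ne_zero |>.1 hterm)

/-- A linear map on `ℝ³` vanishing on the standard basis vanishes. [folklore] -/
theorem clm_eq_zero_of_apply_single {F : Type*} [NormedAddCommGroup F] [NormedSpace ℝ F]
    (T : EuclideanSpace ℝ (Fin 3) →L[ℝ] F) (h : ∀ j : Fin 3, T (EuclideanSpace.single j (1 : ℝ)) = 0) :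
    T = 0 := by
  ext y
  have hy : y = ∑ j : Fin 3, y j • EuclideanSpace.single j (1 : ℝ) := by
    simpa using ((EuclideanSpace.basisFun (Fin 3) ℝ).sum_repr y).symm
  rw [hy, map_sum]
  simp [map_smul, h]

/-- A constant field with rapid spatial decay is zero. [folklore] -/
theorem eq_zero_of_const_of_hasRapidSpatialDecay
    {u : EuclideanSpace ℝ (Fin 3) → EuclideanSpace ℝ (Fin 3)} (hd : HasRapidSpatialDecay u)
    (hconst : ∀ x y : EuclideanSpace ℝ (Fin 3), u x = u y) : u = 0 := by
  obtain ⟨C, hC⟩ := hd 0 1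
  funext x
  rw [hconst x 0]
  by_contra hne
  have ha : 0 < ‖u 0‖ := norm_pos_iff.2 hne
  -- a point far away
  set t : ℝ := (C + 1) / ‖u 0‖ with ht
  set z : EuclideanSpace ℝ (Fin 3) := t • EuclideanSpace.single 0 (1 : ℝ) with hz
  have hzn : ‖z‖ = |t| := by
    rw [hz, norm_smul, PiLp.norm_single, norm_one, mul_one, Real.norm_eq_abs]
  have h1 := hC z
  rw [pow_one, norm_iteratedFDeriv_zero, hconst z 0, hzn] at h1
  have h2 : |t| * ‖u 0‖ ≤ C := by nlinarith [abs_nonneg t]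
  have h3 : t * ‖u 0‖ = C + 1 := by rw [ht]; field_simp
  have h4 : t ≤ |t| := le_abs_self t
  nlinarith

/-- **Step 7 (Theorem 2.5, MMM 2 (2024) p. 25) holds**: in the `Setting`, `b(0) = 0` forces `v₀ = 0`.
`b v 0 = (2π)^{-3/2} (gradNorm (v 0)).toReal` with `v 0 = v₀`; rapid decay gives `gradNorm v₀ ≠ ⊤`, so
`gradNorm v₀ = 0`; the continuous integrand `Σ_j ‖∂_j v₀‖²` then vanishes identically, `∇v₀ ≡ 0`,
`v₀` is constant (`is_const_of_fderiv_eq_zero`), and a rapidly decaying constant is `0`.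
[cite: Ramm2024, Thm. 2.5 p. 25] -/
theorem step7_dataZero_holds : Step7_dataZero := by
  intro ν v₀ v p hS hb
  have h0 : v 0 = v₀ := hS.solution.initial
  have hdec : HasRapidSpatialDecay v₀ := hS.data_decay
  have hC1 : ContDiff ℝ 1 v₀ := contDiff_infty.1 hS.data_smooth 1
  -- `b v 0 = 0` and finiteness give `gradNorm v₀ = 0`
  have hgn : gradNorm v₀ = 0 := by
    have hb' : (2 * Real.pi) ^ (-(3 : ℝ) / 2) * (gradNorm v₀).toReal = 0 := by
      simpa [b, h0] using hb
    have hpi : (2 * Real.pi) ^ (-(3 : ℝ) / 2) ≠ 0 :=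
      (Real.rpow_pos_of_pos (by positivity) _).ne'
    have htr : (gradNorm v₀).toReal = 0 := by
      rcases mul_eq_zero.1 hb' with h | h
      · exact absurd h hpi
      · exact h
    rcases ENNReal.toReal_eq_zero_iff _ |>.1 htr with h | h
    · exact h
    · exact absurd h (gradNorm_ne_top hdec)
  -- every partial vanishes, hence the full derivative
  have hfd : ∀ x, fderiv ℝ v₀ x = 0 := fun x =>
    clm_eq_zero_of_apply_single _ fun j => fderiv_apply_single_eq_zero_of_gradNorm_eq_zero hC1 hgn x j
  have hconst : ∀ x y : EuclideanSpace ℝ (Fin 3), v₀ x = v₀ y :=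
    is_const_of_fderiv_eq_zero (hC1.differentiable one_ne_zero) hfd
  exact eq_zero_of_const_of_hasRapidSpatialDecay hdec hconst

/-! ## Steps 1–2 in the finite-energy class (Clay (7) = print (1.5) p. 20) -/

section EnergyClass

variable {ν : ℝ} {v₀ : EuclideanSpace ℝ (Fin 3) → EuclideanSpace ℝ (Fin 3)}
  {v : ℝ → EuclideanSpace ℝ (Fin 3) → EuclideanSpace ℝ (Fin 3)} {p : ℝ → EuclideanSpace ℝ (Fin 3) → ℝ}

/-- Bounded energy on `[0, ∞)` gives the finite-energy hypothesis of `isLerayHopfOn_of_finiteEnergy`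
on every slab `[0, T]`. [folklore] -/
theorem finiteEnergy_on_Icc (hE : HasBoundedEnergy v) (T : ℝ) :
    ∃ A : ℝ≥0∞, A < ⊤ ∧ ∀ t ∈ Icc 0 T, ∫⁻ x, ‖v t x‖ₑ ^ 2 ≤ A := by
  obtain ⟨C, hC, hb⟩ := hE
  exact ⟨C, hC, fun t ht => hb t ht.1⟩

/-- **A finite-energy solution in the `Setting` is Leray–Hopf on every `[0, T)`** (Tao 2013,
Lemma 8.1, tree theorem `isLerayHopfOn_of_finiteEnergy`), with datum `v₀ = v 0`.
[cite: Tao2011, Lemma 8.1 (arXiv:1108.1165)] -/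
theorem isLerayHopfOn_of_setting (hS : Setting ν v₀ v p) (hE : HasBoundedEnergy v) {T : ℝ}
    (hT : 0 < T) : IsLerayHopfOn T ν 0 v₀ v ∧ ContinuousInLpOn (Icc 0 T) 2 v := by
  have hcl : IsClassicalNSSolutionOn (Icc 0 T) ν 0 v p :=
    hS.solution.isClassicalNSSolutionOn_Icc hS.velocity_smooth hS.pressure_smooth hT
  have h := isLerayHopfOn_of_finiteEnergy hcl hS.viscosity_pos hT (finiteEnergy_on_Icc hE T)
  rw [hS.solution.initial] at h
  exact h

/-- The datum of a finite-energy solution in the `Setting` is in `L²`. [folklore] -/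
theorem memLp_data_of_setting (hS : Setting ν v₀ v p) (hE : HasBoundedEnergy v) :
    MemLp v₀ 2 volume := by
  have h := (isLerayHopfOn_of_setting hS hE one_pos).1.memLp 0 ⟨le_rfl, zero_le_one⟩
  rwa [hS.solution.initial] at h

/-- **Step 1 in the finite-energy class** — (1.6) p. 20 / (1.12) p. 21 («problem (1.1)–(1.4) is
equivalent to the integral equation (1.6)», the direction used): a solution in the `Setting` with
bounded energy is a global mild (Duhamel) solution in the tree's duality form (Fabes–Jones–Rivière
1972, Thm. 2.1 via Leray–Hopf; tree `IsLerayHopfOn.isMildNSSolutionOn_Ioc`; at `t = 0` the identity is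
the initial condition and weak divergence-freeness is Gauss–Green, `IsDivFree.isWeaklyDivFree_holds`).
[cite: FabesJonesRiviere1972, Thm. 2.1] -/
theorem step1_integralEquation_of_hasBoundedEnergy (hS : Setting ν v₀ v p)
    (hE : HasBoundedEnergy v) : IsGlobalMildSolution ν 0 v₀ v := by
  refine ⟨fun t ht => ?_, fun t ht => ?_⟩
  · have ht0 : 0 ≤ t := ht
    have hT : 0 < t + 1 := by linarith
    have hcl : IsClassicalNSSolutionOn (Icc 0 (t + 1)) ν 0 v p :=
      hS.solution.isClassicalNSSolutionOn_Icc hS.velocity_smooth hS.pressure_smooth hT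
    have htm : t ∈ Icc 0 (t + 1) := ⟨ht0, by linarith⟩
    exact VectorCalculus.IsDivFree.isWeaklyDivFree_holds (hcl.divFree t htm)
      (contDiff_infty.1 (hcl.contDiff_velocity htm) 1)
  · have ht0 : 0 ≤ t := ht
    rcases ht0.eq_or_lt with h | hpos
    · subst h
      rw [isMildNSSolutionFrom_zero_iff]
      intro φ _ _
      rw [hS.solution.initial]
    · obtain ⟨hLH, -⟩ := isLerayHopfOn_of_setting hS hE hpos
      have hE3 : Module.finrank ℝ (EuclideanSpace ℝ (Fin 3)) = 3 := by
        rw [finrank_euclideanSpace, Fintype.card_fin]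
      exact (hLH.isMildNSSolutionOn_Ioc hE3 (memLp_data_of_setting hS hE) hS.viscosity_pos hpos).2
        t ⟨hpos, le_rfl⟩

/-- **Step 2 in the finite-energy class** — Theorem 1.1 (1.15) p. 21 with `f ≡ 0`:
`‖v(·,t)‖₂ ≤ ‖v₀‖₂` for every `t ≥ 0`, from Leray's energy inequality
`½‖v(t)‖₂² + ν∫₀ᵗ‖∇v‖₂² ≤ ½‖v₀‖₂²` of the Leray–Hopf solution that a finite-energy classical solution
is (tree `isLerayHopfOn_of_finiteEnergy`, field `IsLerayHopfOn.weakGrad_energy`).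
[cite: Leray1934, §31 (b)–(c)] -/
theorem step2_energyBound_of_hasBoundedEnergy (hS : Setting ν v₀ v p) (hE : HasBoundedEnergy v) :
    ∀ t : ℝ, 0 ≤ t → eLpNorm (v t) 2 volume ≤ eLpNorm v₀ 2 volume := by
  intro t ht
  rcases ht.eq_or_lt with h | hpos
  · subst h
    rw [hS.solution.initial]
  obtain ⟨hLH, -⟩ := isLerayHopfOn_of_setting hS hE hpos
  obtain ⟨G, -, -, hEI, -⟩ := hLH.weakGrad_energy
  have hineq := hEI t ⟨ht, le_rfl⟩
  have hmt : MemLp (v t) 2 volume := hLH.memLp t ⟨ht, le_rfl⟩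
  have hm0 : MemLp v₀ 2 volume := memLp_data_of_setting hS hE
  have hforce : (∫ τ in (0 : ℝ)..t, ∫ x,
      inner ℝ ((0 : ℝ → EuclideanSpace ℝ (Fin 3) → EuclideanSpace ℝ (Fin 3)) τ x) (v τ x)) = 0 := by
    simp
  have hD : 0 ≤ ν * (∫⁻ τ in Ioo 0 t, ∫⁻ x,
      ENNReal.ofReal (frobeniusNormSq (G τ x))).toReal :=
    mul_nonneg hS.viscosity_pos.le ENNReal.toReal_nonneg
  have hKE : VectorCalculus.kineticEnergy (v t) ≤ VectorCalculus.kineticEnergy v₀ := by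
    rw [hforce, add_zero] at hineq
    linarith
  rw [kineticEnergy_eq_half_toReal_eLpNorm_sq hmt, kineticEnergy_eq_half_toReal_eLpNorm_sq hm0]
    at hKE
  have hsq : (eLpNorm (v t) 2 volume).toReal ^ 2 ≤ (eLpNorm v₀ 2 volume).toReal ^ 2 := by
    linarith
  have hle : (eLpNorm (v t) 2 volume).toReal ≤ (eLpNorm v₀ 2 volume).toReal :=
    le_of_sq_le_sq (by rw [sq, sq] at hsq; nlinarith [hsq]) ENNReal.toReal_nonneg
  exact (ENNReal.toReal_le_toReal hmt.eLpNorm_ne_top hm0.eLpNorm_ne_top).1 hle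

/-- Packaged in the skeleton's quantifier shape: Step 1 holds for every solution of the `Setting`
that has bounded energy. [cite: FabesJonesRiviere1972, Thm. 2.1] -/
theorem step1_integralEquation_energyClass :
    ∀ (ν : ℝ) (v₀ : EuclideanSpace ℝ (Fin 3) → EuclideanSpace ℝ (Fin 3))
      (v : ℝ → EuclideanSpace ℝ (Fin 3) → EuclideanSpace ℝ (Fin 3)) (p : ℝ → EuclideanSpace ℝ (Fin 3) → ℝ),
      Setting ν v₀ v p → HasBoundedEnergy v → IsGlobalMildSolution ν 0 v₀ v :=
  fun _ _ _ _ hS hE => step1_integralEquation_of_hasBoundedEnergy hS hE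

/-- Packaged in the skeleton's quantifier shape: Step 2 holds for every solution of the `Setting`
that has bounded energy. [cite: Leray1934, §31 (b)–(c)] -/
theorem step2_energyBound_energyClass :
    ∀ (ν : ℝ) (v₀ : EuclideanSpace ℝ (Fin 3) → EuclideanSpace ℝ (Fin 3))
      (v : ℝ → EuclideanSpace ℝ (Fin 3) → EuclideanSpace ℝ (Fin 3)) (p : ℝ → EuclideanSpace ℝ (Fin 3) → ℝ),
      Setting ν v₀ v p → HasBoundedEnergy v →
        ∀ t : ℝ, 0 ≤ t → eLpNorm (v t) 2 volume ≤ eLpNorm v₀ 2 volume :=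
  fun _ _ _ _ hS hE => step2_energyBound_of_hasBoundedEnergy hS hE

end EnergyClass

/-! ## Steps 1–2 as typed (skeleton rev 2, p459786: `Setting` carries `energy : HasBoundedEnergy v`) -/

/-- **Step 1 holds as typed** — (1.6) p. 20 / (1.12) p. 21: every solution of the `Setting` (rev 2: bounded
energy (1.5) = Clay (7) is a field of `Setting`) is a global mild (Duhamel) solution; one line from
`step1_integralEquation_of_hasBoundedEnergy`. [cite: FabesJonesRiviere1972, Thm. 2.1] -/
theorem step1_integralEquation_holds : Step1_integralEquation :=
  fun _ _ _ _ hS => step1_integralEquation_of_hasBoundedEnergy hS hS.energy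

/-- **Step 2 holds as typed** — Theorem 1.1 (1.15) p. 21 (`f ≡ 0`): `‖v(·,t)‖₂ ≤ ‖v₀‖₂` for all `t ≥ 0`
for every solution of the `Setting` (rev 2); one line from `step2_energyBound_of_hasBoundedEnergy`.
[cite: Leray1934, §31 (b)–(c)] -/
theorem step2_energyBound_holds : Step2_energyBound :=
  fun _ _ _ _ hS => step2_energyBound_of_hasBoundedEnergy hS hS.energy

end Ramm2024

end Summit.NavierStokesRegularity.NavierStokesRegularity.Theorems

end
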